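import Literature.NumberTheory.GelbartRogawski1991.LocalUnitarySplittingDatum
import Literature.NumberTheory.Automorphic.UnitaryGroupFinAdelicCenterLocal
import HarnessLib

/-!
# The centre of `U(J)(F_v)` acts on `𝕎_v = reIm(E_vᴺ)` by the scalar — for EVERY rank `N`
(Mœglin–Vignéras–Waldspurger 1987, Ch. 1 I.17; Mok 2015 §1: the centre of `U_{E/F}(N)` is `U_{E/F}(1) = E¹`)

Topic `NumberTheory/Automorphic`; namespace `Literature.NumberTheory.Automorphic.UnitaryGroup`.  One definition with a
body (`localUnitScalar`) and theorems; no named fact, no `sorry`.  Helper node (H18) of B-p02's route R6″ for the named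
fact `mvw_IV4_rankOne_irreducibleOrZero` (cell hodgecm-mathlib): the standing-data-free version of the private lemma
`iota_localCenter_theta_reIm` of `RankOneThetaLiftNonvanishingProofs` (which goes through `LemD1OfPlace.theta` and
therefore needs `N ≥ 2`).

* `UnitaryGroup.localUnitScalar c J₁ v z hz : localPi E c 1 J₁ v` — a norm-one scalar `z ∈ E_v = E ⊗_F F_v`
  (`z · (c ⊗ 1) z = 1`) as an element of `U(J₁)(F_v)` for a Hermitian line `J₁`: the regrouped `1 × 1` matrix `(z)`
  (`scalar_mem_unitaryGroupOfForm`);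
* `coe_localPiEquiv_localCenter_localUnitScalar` — under `localCenter : U(J₁)(F_v) → U(J)(F_v)` it becomes the scalar
  matrix `z · 1_N ∈ GL_N(E_v)`;
* `iota_localCenter_localUnitScalar_reIm` — **`ι_v` of that central element acts on `𝕎_v = reIm(E_vᴺ)` as
  `reIm y ↦ reIm (z • y)`** (`localToSymplectic_reIm`), for every `N`.

References: C. Mœglin, M.-F. Vignéras, J.-L. Waldspurger, *Correspondances de Howe sur un corps p-adique*, LNM 1291
(1987), Ch. 1 I.17 [MoeglinVignerasWaldspurger1987]; C. P. Mok, Mem. AMS 235 (2015), §1 Notation p. 5 [Mok2014].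
-/

set_option autoImplicit false

noncomputable section

open scoped Matrix
open NumberField IsDedekindDomain

namespace Literature.NumberTheory.Automorphic.UnitaryGroup

variable {F : Type} (E : Type) [Field F] [NumberField F] [Field E] [NumberField E] [Algebra F E]
variable (c : E ≃ₐ[F] E) (N : ℕ) (J : Matrix (Fin N) (Fin N) E) (J₁ : Matrix (Fin 1) (Fin 1) E)
  (v : HeightOneSpectrum (𝓞 F))

/-! ## §1 A norm-one scalar of `E_v` as an element of `U(J₁)(F_v)` -/

/-- **a norm-one scalar `z ∈ E_v` (`z · (c ⊗ 1) z = 1`) as an element of `U(J₁)(F_v) ≤ Π_{w ∣ v} GL_1(E_w)`**: the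
`1 × 1` scalar matrix `(z)` over `E_v = Π_{w ∣ v} E_w`, regrouped (`localGLPiEquiv`).  It lies in `U(J₁)` for every line
`J₁` (`scalar_mem_unitaryGroupOfForm`: `σ(z) j z = j`).  (Definitionally `localGLPiEquiv (OscillatorStandingData.unitScalar
1 z)`.) [cite: Mok2014, §1 Notation p. 5] -/
def localUnitScalar (z : (LocalRing E v)ˣ) (hz : (z : LocalRing E v) * conjLocal E c v z = 1) : localPi E c 1 J₁ v :=
  ⟨localGLPiEquiv E 1 v
      (Units.map (Matrix.scalar (Fin 1) : LocalRing E v →+* Matrix (Fin 1) (Fin 1) (LocalRing E v)).toMonoidHom z),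
    (localGLPiEquiv_mem_localPi_iff E c 1 J₁ v _).2
      (scalar_mem_unitaryGroupOfForm (conjLocal E c v) _ z (by rw [mul_comm]; exact hz))⟩

/-- the regrouped matrix underlying `localUnitScalar z`: `localGLPiEquiv.symm` of it is the scalar matrix `(z)`.
[cite: Mok2014, §1 Notation p. 5] -/
theorem coe_localPiEquiv_localUnitScalar (z : (LocalRing E v)ˣ) (hz : (z : LocalRing E v) * conjLocal E c v z = 1) :
    ((localPiEquiv E c 1 J₁ v (localUnitScalar E c J₁ v z hz)).1 : GL (Fin 1) (LocalRing E v)).val =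
      (z : LocalRing E v) • (1 : Matrix (Fin 1) (Fin 1) (LocalRing E v)) := by
  change ((localGLPiEquiv E 1 v).symm (localGLPiEquiv E 1 v
      (Units.map (Matrix.scalar (Fin 1) : LocalRing E v →+* Matrix (Fin 1) (Fin 1) (LocalRing E v)).toMonoidHom z))).val = _
  rw [ContinuousMulEquiv.symm_apply_apply]
  change Matrix.scalar (Fin 1) (z : LocalRing E v) = _
  rw [Matrix.scalar_apply, Matrix.smul_one_eq_diagonal]

/-- the `w`-component of `localUnitScalar z` is the `1 × 1` matrix `(z_w)`. [cite: Mok2014, §1 Notation p. 5] -/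
theorem coe_localUnitScalar_apply (z : (LocalRing E v)ˣ) (hz : (z : LocalRing E v) * conjLocal E c v z = 1)
    (w : PlacesOver E v) :
    ((((localUnitScalar E c J₁ v z hz : localPi E c 1 J₁ v) : LocalGLPi E 1 v) w : GL (Fin 1) (w.1.adicCompletion E)) :
        Matrix (Fin 1) (Fin 1) (w.1.adicCompletion E)) 0 0 = (z : LocalRing E v) w := by
  change ((Matrix.scalar (Fin 1) (z : LocalRing E v)).map (Pi.evalRingHom _ w)) 0 0 = _
  rw [Matrix.map_apply, Matrix.scalar_apply, Matrix.diagonal_apply_eq]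
  rfl

/-! ## §2 Its image under the local centre `U(J₁)(F_v) → U(J)(F_v)` is the scalar matrix `z · 1_N` -/

/-- **`localCenter (localUnitScalar z) = z · 1_N`** in `GL_N(E_v)` (through `localPiEquiv`). [cite: Mok2014, §1 Notation p. 5] -/
theorem coe_localPiEquiv_localCenter_localUnitScalar (hJ₁ : J₁ 0 0 ≠ 0) (z : (LocalRing E v)ˣ)
    (hz : (z : LocalRing E v) * conjLocal E c v z = 1) :
    ((localPiEquiv E c N J v (localCenter E c N J J₁ hJ₁ v (localUnitScalar E c J₁ v z hz))).1 :
        GL (Fin N) (LocalRing E v)).val = (z : LocalRing E v) • (1 : Matrix (Fin N) (Fin N) (LocalRing E v)) := by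
  change ((localGLPiEquiv E N v).symm (localScalarGL E N v (localUnitScalar E c J₁ v z hz : LocalGLPi E 1 v))).val = _
  ext a b w
  rw [GLn.coe_piEquiv_symm_apply, coe_localScalarGL_apply, coe_localUnitScalar_apply, Matrix.smul_apply,
    Matrix.smul_apply, smul_eq_mul, smul_eq_mul, Pi.mul_apply, Matrix.one_apply, Matrix.one_apply]
  split_ifs <;> rfl

/-! ## §3 `ι_v` of the central element acts on `𝕎_v` by the scalar -/

open Literature.NumberTheory.GelbartRogawski1991.UnitaryDualPair.LocalSplitting in
/-- **the centre acts on `𝕎_v = reIm(E_vᴺ)` by the scalar, for EVERY `N`**: for a norm-one scalar `z ∈ E_v` and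
the central element `localCenter (localUnitScalar z) ∈ U(J)(F_v)`, `J = T ⊗ 1`,
`ι_v(localCenter (localUnitScalar z)) (reIm y) = reIm (z • y)` for all `y ∈ E_vᴺ`
(`iota_def`, `localPiToSymplectic = localToSymplectic ∘ localPiEquiv`, `localToSymplectic_reIm`, §2).
[cite: MoeglinVignerasWaldspurger1987, Ch. 1 I.17] -/
theorem iota_localCenter_localUnitScalar_reIm [Algebra.IsQuadraticExtension F E] {δ : E} (hcδ : c δ = -δ)
    (hδ : δ ≠ 0) {d : F} (hd : δ * δ = algebraMap F E d) (T : Matrix (Fin N) (Fin N) F) (hT : T.IsSymm)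
    (hJ : J = T.map (algebraMap F E)) (hJ₁ : J₁ 0 0 ≠ 0) (z : (LocalRing E v)ˣ)
    (hz : (z : LocalRing E v) * conjLocal E c v z = 1) (y : Fin N → LocalRing E v) :
    (iota F E c N hcδ hδ hd T hT hJ v (localCenter E c N J J₁ hJ₁ v (localUnitScalar E c J₁ v z hz))).1
        (QuadraticCoordinates.reIm (quadraticLocalEquiv E v c hcδ hδ).toLinearEquiv.toAddEquiv (Fin N) y) =
      QuadraticCoordinates.reIm (quadraticLocalEquiv E v c hcδ hδ).toLinearEquiv.toAddEquiv (Fin N)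
        ((z : LocalRing E v) • y) := by
  rw [iota_def]
  change (localToSymplectic E c N v hcδ hδ hd hT hJ
    (localPiEquiv E c N J v (localCenter E c N J J₁ hJ₁ v (localUnitScalar E c J₁ v z hz)))).1 _ = _
  rw [localToSymplectic_reIm, coe_localPiEquiv_localCenter_localUnitScalar, Matrix.smul_mulVec,
    Matrix.one_mulVec]

end Literature.NumberTheory.Automorphic.UnitaryGroup

end
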